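import Summits.CriticalPhenomena.PercolationContinuityZ3.Theorems.Transplant.GrigorchukLamplighterCylinderStep
import Summits.CriticalPhenomena.PercolationContinuityZ3.Theorems.Transplant.CayleyCylinderKit
import HarnessLib

/-!
# Cylinder kits on Bartholdi–Erschler's graph, I: coordinates (`bs`, `idx`), the lamp lines `u, u s, u s², …` inside the big block-sum
# cylinder `Cay[‖bs‖_∞ ≤ ℓ+1]`, and the column of a vertex up to the ceiling

builds on p205010 (kernel theorem, internal audit signed; external expert review pending) — nothing in this file uses p205010.  Lane `prim-bschramm`, seat `prim-bschramm-p3` gen 38 (DESIGN OWNER; offer O17 = O3-direct,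
`P3-NILPOTENT.md` §31; lead GO 2026-08-28 12:11Z, refuter note 12:14Z).  Helper file (`--supports stmt-CriticalPhenomena-4575 --as helper`).  Nothing is
claimed here about `θ(p_c)`; this is walk bookkeeping for the Aizenman–Grimmett kits of the sequel files.

THE OBJECTS.  `Γ₂ = ℤ ≀_X 𝔊 = wreathZ` with Bartholdi–Erschler's standard letters `a, b, c, d, s` («GrigorchukLamplighterDefs», «…ShortCycles» `stdGens`),
`Cay = mulCayley stdGens` («…CayleyClasses»), spelled here REDUCIBLY as `CayS` (`= Cay` by `rfl`, `cayS_eq`) so that rewriting inside walks stays syntactic;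
the block sums `bs u = (Σ_{X₀} f, Σ_{X₁} f)` of `u = (f, g)` and the block `idx u ∈ {0, 1}` of the lamplighter's position `g·ρ`; the block-sum cylinders
`blockCyl (box 2 L) = {‖bs‖_∞ ≤ L}` («…CylinderReduction» p627522) and the induced graphs `cylH L = CayS[blockCyl (box 2 L)]`.
* §1 `bs`/`idx` along the letters: an `s^{±1}`-edge moves `bs` by `± e_{idx}` and keeps the tree part (`bs_mul_sW`, `bs_mul_sW_pow`, `right_mul_sW_pow`, …);
  `b, c, d` keep `bs` and `idx` (they fix `ρ`: `toW_rho_of_isTree`, `sW_pow_mul_toW_of_isTree`); `a` keeps `bs` and SWITCHES `idx` (`idx_mul_aW`: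
  `g·ρ` and `g·a·ρ` lie in different level-one subtrees, `firstLetter_dichotomy`); powers of `s` are distinct (`sW_pow_injective`).
* §2 the power walks of «CayleyCylinderWalks» (`CayCyl.powWalk`) along `s` / `s⁻¹` stay in the big cylinder when their far end does (`line_mem`, `linei_mem`);
  the enhancement class `Eenh ℓ` (edges of `cylH (ℓ+1)` not inside box `ℓ`); `K x = ℓ + 1 − bs x (idx x)` steps to the ceiling, the top `pt x = x s^K`
  (own block sum `ℓ + 1`, `bs_pt_idx`, outside the small cylinder `bs_pt_not_mem`), and **the column `colA x : x → pt x`** as a path of `cylH (ℓ+1)` (`colA_isPath`,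
  `mem_colA`).
[cite: BartholdiErschler2012, §2 (standard generating set), §3.1 (ρ = 1^∞ fixed by b, c, d)] [cite: KozmaNitzan2024, §4 p. 15 (boxes)]
[cite: AizenmanGrimmett1991, Thm 1 (essential enhancements)]
-/

noncomputable section

namespace Summit.CriticalPhenomena.PercolationContinuityZ3.Theorems.Transplant

namespace Grigorchuk

open SimpleGraph Walk SemidirectProduct Literature.Probability.LatticeModels SubLoc CayCyl
open Literature.Barriers.CriticalPhenomena (graphBall graphBall_mono)
open scoped Classical

/-! ## §1 Coordinates: the two block sums and the block of the lamplighter's position -/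

/-- The two level-one block sums `(Σ_{X₀} f, Σ_{X₁} f)` of a vertex `u = (f, g)` of `Γ₂`. [cite: BartholdiErschler2012, §3.1] -/
def bs (u : ↥wreathZ) : Fin 2 → ℤ := blockSum (Multiplicative.toAdd ((u : LampGroup ℤ)).left)

/-- The block (`0` or `1`) of the lamplighter's position `g·ρ` at the vertex `u = (f, g)`. [cite: BartholdiErschler2012, §3.1] -/
def idx (u : ↥wreathZ) : Fin 2 := if ((u : LampGroup ℤ)).right rho 0 then 1 else 0

/-- Membership in a block-sum cylinder is a condition on `bs`. [folklore] -/
theorem mem_blockCyl_bs {B : Finset (Site 2)} {u : ↥wreathZ} : u ∈ blockCyl B ↔ bs u ∈ B := Iff.rfl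

/-- An `s`-edge raises the block sum of the current block by one. [cite: BartholdiErschler2012, §2] -/
theorem bs_mul_sW (u : ↥wreathZ) : bs (u * sW) = bs u + Pi.single (idx u) 1 := blockSum_mul_lamp u 1 sW coe_sW

/-- An `s⁻¹`-edge lowers the block sum of the current block by one. [cite: BartholdiErschler2012, §2] -/
theorem bs_mul_sWi (u : ↥wreathZ) : bs (u * sW⁻¹) = bs u + Pi.single (idx u) (-1) :=
  blockSum_mul_lamp u (-1) sW⁻¹ (by rw [Subgroup.coe_inv, coe_sW, lamp_inv])

/-- `s^{±1}`-edges do not move the lamplighter. [folklore] -/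
theorem right_mul_sW (u : ↥wreathZ) : (((u * sW : ↥wreathZ)) : LampGroup ℤ).right = ((u : LampGroup ℤ)).right := by
  rw [Subgroup.coe_mul, mul_right, right_sW, mul_one]

/-- Hence the block index is unchanged along `s`-edges. [folklore] -/
theorem idx_mul_sW (u : ↥wreathZ) : idx (u * sW) = idx u := by unfold idx; rw [right_mul_sW]

/-- Hence the block index is unchanged along `s⁻¹`-edges. [folklore] -/
theorem idx_mul_sWi (u : ↥wreathZ) : idx (u * sW⁻¹) = idx u := by
  unfold idx; rw [Subgroup.coe_mul, Subgroup.coe_inv, mul_right, inv_right, right_sW, inv_one, mul_one]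

/-- Tree letters keep the lamps. [folklore] -/
theorem bs_mul_tree (u : ↥wreathZ) {t : ↥wreathZ} (ht : ((t : LampGroup ℤ)).left = 1) : bs (u * t) = bs u := by
  unfold bs; rw [left_mul_of_left_eq_one u t ht]

/-- Tree parts multiply. [folklore] -/
theorem right_mul (u t : ↥wreathZ) : (((u * t : ↥wreathZ)) : LampGroup ℤ).right = ((u : LampGroup ℤ)).right * ((t : LampGroup ℤ)).right := by
  rw [Subgroup.coe_mul, mul_right]

/-- `b, c, d` keep the lamp position: the block index is unchanged. [cite: BartholdiErschler2012, §3.1 (ρ fixed by b, c, d)] -/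
theorem idx_mul_of_fix (u : ↥wreathZ) {t : ↥wreathZ} (ht : ((t : LampGroup ℤ)).right rho = rho) : idx (u * t) = idx u := by
  unfold idx; rw [right_mul, Equiv.Perm.mul_apply, ht]

/-- **`a` switches the block**: the lamp positions `g·ρ` and `g·a·ρ` lie in different level-one subtrees. [cite: BartholdiErschler2012, §3.1] -/
theorem idx_mul_aW (u : ↥wreathZ) : idx (u * aW) ≠ idx u := by
  unfold idx
  rw [right_mul, Equiv.Perm.mul_apply, right_aW]
  rcases firstLetter_dichotomy u with h | h
  · rw [h (genA rho), h rho, genA_rho_zero, rho_zero]; simp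
  · rw [h (genA rho), h rho, genA_rho_zero, rho_zero]; simp

/-- Block sums along the `s`-line: `bs (u s^n) = bs u + n e_{idx u}`. [folklore] -/
theorem bs_mul_sW_pow (u : ↥wreathZ) (n : ℕ) : bs (u * sW ^ n) = bs u + Pi.single (idx u) (n : ℤ) ∧ idx (u * sW ^ n) = idx u := by
  induction n with
  | zero => simp
  | succ n ih =>
    rw [pow_succ, ← mul_assoc, bs_mul_sW, idx_mul_sW, ih.1, ih.2, add_assoc, ← Pi.single_add]
    exact ⟨by push_cast; rfl, rfl⟩

/-- Block sums along the `s⁻¹`-line: `bs (u s^{-n}) = bs u − n e_{idx u}`. [folklore] -/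
theorem bs_mul_sWi_pow (u : ↥wreathZ) (n : ℕ) : bs (u * sW⁻¹ ^ n) = bs u + Pi.single (idx u) (-(n : ℤ)) ∧ idx (u * sW⁻¹ ^ n) = idx u := by
  induction n with
  | zero => simp
  | succ n ih =>
    rw [pow_succ, ← mul_assoc, bs_mul_sWi, idx_mul_sWi, ih.1, ih.2, add_assoc, ← Pi.single_add]
    exact ⟨by push_cast; ring_nf, rfl⟩

/-- Tree parts along the `s`-line. [folklore] -/
theorem right_mul_sW_pow (u : ↥wreathZ) (n : ℕ) : (((u * sW ^ n : ↥wreathZ)) : LampGroup ℤ).right = ((u : LampGroup ℤ)).right := by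
  induction n with
  | zero => simp
  | succ n ih => rw [pow_succ, ← mul_assoc, right_mul_sW, ih]

/-- Tree parts along the `s⁻¹`-line. [folklore] -/
theorem right_mul_sWi_pow (u : ↥wreathZ) (n : ℕ) : (((u * sW⁻¹ ^ n : ↥wreathZ)) : LampGroup ℤ).right = ((u : LampGroup ℤ)).right := by
  induction n with
  | zero => simp
  | succ n ih => rw [pow_succ, ← mul_assoc, Subgroup.coe_mul, Subgroup.coe_inv, mul_right, inv_right, right_sW, inv_one, mul_one, ih]

/-- `bs 1 = 0`. [folklore] -/
theorem bs_one : bs 1 = 0 := by unfold bs; simp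

/-- `idx 1 = 1` (the base ray `ρ = 1^∞` starts with `1`). [folklore] -/
theorem idx_one : idx 1 = 1 := by unfold idx; simp [rho]

/-- Powers of `s` are distinct. [folklore] -/
theorem sW_pow_injective (i j : ℕ) (h : sW ^ i = sW ^ j) : i = j := by
  have h1 := (bs_mul_sW_pow 1 i).1; have h2 := (bs_mul_sW_pow 1 j).1
  rw [one_mul] at h1 h2
  rw [h, h2, bs_one, idx_one, zero_add, zero_add] at h1
  have := congrFun h1 1
  simp at this; omega

/-- Powers of `s⁻¹` are distinct. [folklore] -/
theorem sWi_pow_injective (i j : ℕ) (h : sW⁻¹ ^ i = sW⁻¹ ^ j) : i = j := by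
  rw [inv_pow, inv_pow, inv_inj] at h; exact sW_pow_injective i j h

/-- B–E's graph `Cay(ℤ ≀_X 𝔊; a,b,c,d,s)` spelled REDUCIBLY as `mulCayley stdGens` (= `Cay` by `rfl`; the abbreviation keeps rewriting inside walks syntactic).
[cite: BartholdiErschler2012, §2 (standard generating set)] -/
abbrev CayS : SimpleGraph ↥wreathZ := mulCayley (↑stdGens : Set ↥wreathZ)

/-- `CayS = Cay`. [folklore] -/
theorem cayS_eq : CayS = Cay := rfl

/-- `a`-edges. [cite: BartholdiErschler2012, §2 (standard generating set)] -/
theorem cay_adj_aW (u : ↥wreathZ) : CayS.Adj u (u * aW) := cay_adj_mul u .a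

/-- `b`-edges. [cite: BartholdiErschler2012, §2 (standard generating set)] -/
theorem cay_adj_bW (u : ↥wreathZ) : CayS.Adj u (u * bW) := cay_adj_mul u .b

/-- `s`-edges. [cite: BartholdiErschler2012, §2 (standard generating set)] -/
theorem cay_adj_sW (u : ↥wreathZ) : CayS.Adj u (u * sW) := cay_adj_mul u .s

/-- `s⁻¹`-edges. [cite: BartholdiErschler2012, §2 (standard generating set)] -/
theorem cay_adj_sWi (u : ↥wreathZ) : CayS.Adj u (u * sW⁻¹) := cay_adj_mul u .si


/-- The three tree letters `b, c, d` have trivial lamp part. [folklore] -/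
theorem toW_left_of_isTree {t : L6} (hc : t.isTree = true) : (((t.toW : ↥wreathZ)) : LampGroup ℤ).left = 1 := by
  cases t <;> simp [L6.isTree] at hc <;> rfl

/-- `b, c, d` fix the base ray `ρ`. [cite: BartholdiErschler2012, §3.1 (ρ = 1^∞ fixed by b, c, d)] -/
theorem toW_rho_of_isTree {t : L6} (hc : t.isTree = true) : (((t.toW : ↥wreathZ)) : LampGroup ℤ).right rho = rho := by
  cases t <;> simp [L6.isTree] at hc
  · exact genB_rho
  · exact genC_rho
  · exact genD_rho

/-- `s` commutes with `b, c, d`. [cite: BartholdiErschler2012, §3.1] -/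
theorem sW_mul_toW_of_isTree {t : L6} (hc : t.isTree = true) : sW * t.toW = t.toW * sW := by
  cases t <;> simp [L6.isTree] at hc
  · exact sW_comm.1
  · exact sW_comm.2.1
  · exact sW_comm.2.2

/-- `sⁿ` commutes with `b, c, d`. [folklore] -/
theorem sW_pow_mul_toW_of_isTree {t : L6} (hc : t.isTree = true) (n : ℕ) : sW ^ n * t.toW = t.toW * sW ^ n :=
  ((Commute.pow_left (sW_mul_toW_of_isTree hc) n)).eq

/-- `sⁿ b = b sⁿ`. [folklore] -/
theorem sW_pow_mul_bW (n : ℕ) : sW ^ n * bW = bW * sW ^ n := sW_pow_mul_toW_of_isTree (t := .b) rfl n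

/-- A letter with trivial tree part and trivial lamp part would be `1`; so `b, c, d` have non-trivial tree part. [folklore] -/
theorem right_toW_ne_one {t : L6} (hc : t.isTree = true) : (((t.toW : ↥wreathZ)) : LampGroup ℤ).right ≠ 1 := by
  intro h
  apply toW_ne_one t
  exact Subtype.ext (SemidirectProduct.ext (by rw [toW_left_of_isTree hc]; rfl) (by rw [h]; rfl))

/-- `a` has non-trivial tree part (it moves `ρ`). [cite: Grigorchuk1980, definition of a] -/
theorem genA_ne_one : genA ≠ 1 := by
  intro h
  have := genA_rho_zero
  rw [h, Equiv.Perm.one_apply, rho_zero] at this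
  exact Bool.noConfusion this

/-- Vertices with different tree parts are different. [folklore] -/
theorem ne_of_right_ne {u v : ↥wreathZ} (h : ((u : LampGroup ℤ)).right ≠ ((v : LampGroup ℤ)).right) : u ≠ v :=
  fun e => h (by rw [e])

/-! ## §2 The cylinder graphs and the lamp lines inside the big cylinder -/

/-- **The block-sum cylinder graph** `Cay[‖bs‖_∞ ≤ L]` (induced subgraph of B–E's graph). [cite: KozmaNitzan2024, §4 p. 15 (boxes)] -/
abbrev cylH (L : ℕ) : SimpleGraph ↥(blockCyl (box 2 L)) := CayS.induce (blockCyl (box 2 L))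

/-- An `s`-line segment whose top stays below the ceiling lies in the big cylinder. [folklore] -/
theorem line_mem {L : ℕ} {u : ↥wreathZ} (hu : u ∈ blockCyl (box 2 L)) {n : ℕ} (hn : bs u (idx u) + n ≤ L) :
    ∀ z ∈ (powWalk stdGens cay_adj_sW u n).support, z ∈ blockCyl (box 2 L) := by
  intro z hz
  obtain ⟨i, hi, rfl⟩ := (mem_support_powWalk _).1 hz
  rw [mem_blockCyl_bs, (bs_mul_sW_pow u i).1, mem_box]
  have hu' := mem_box.1 (mem_blockCyl_bs.1 hu)
  intro j
  by_cases hj : j = idx u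
  · subst hj
    rw [Pi.add_apply, Pi.single_eq_same]
    have := hu' (idx u)
    have hi' : (i : ℤ) ≤ n := by exact_mod_cast hi
    constructor <;> omega
  · rw [Pi.add_apply, Pi.single_eq_of_ne hj, add_zero]
    exact hu' j

/-- An `s⁻¹`-line segment whose bottom stays above the floor lies in the big cylinder. [folklore] -/
theorem linei_mem {L : ℕ} {u : ↥wreathZ} (hu : u ∈ blockCyl (box 2 L)) {n : ℕ} (hn : -(L : ℤ) ≤ bs u (idx u) - n) :
    ∀ z ∈ (powWalk stdGens cay_adj_sWi u n).support, z ∈ blockCyl (box 2 L) := by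
  intro z hz
  obtain ⟨i, hi, rfl⟩ := (mem_support_powWalk _).1 hz
  rw [mem_blockCyl_bs, (bs_mul_sWi_pow u i).1, mem_box]
  have hu' := mem_box.1 (mem_blockCyl_bs.1 hu)
  intro j
  by_cases hj : j = idx u
  · subst hj
    rw [Pi.add_apply, Pi.single_eq_same]
    have := hu' (idx u)
    have hi' : (i : ℤ) ≤ n := by exact_mod_cast hi
    constructor <;> omega
  · rw [Pi.add_apply, Pi.single_eq_of_ne hj, add_zero]
    exact hu' j

section Kit

variable {ℓ : ℕ} (x y : ↥(blockCyl (box 2 (ℓ + 1))))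

/-- **The enhancement class**: edges of the big cylinder graph not inside the small cylinder `‖bs‖_∞ ≤ ℓ`. [folklore] -/
def Eenh (ℓ : ℕ) : Set (Sym2 ↥(blockCyl (box 2 (ℓ + 1)))) := {d | d ∈ (cylH (ℓ + 1)).edgeSet ∧ ¬ ∀ z ∈ d, bs z.1 ∈ box 2 ℓ}

/-- Steps from `x` up to the ceiling `ℓ + 1` along its own axis: `ℓ + 1 − bs x (idx x)`. [folklore] -/
def K : ℕ := ((ℓ : ℤ) + 1 - bs x.1 (idx x.1)).toNat

/-- `K` as an integer. [folklore] -/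
theorem K_eq : (K x : ℤ) = ℓ + 1 - bs x.1 (idx x.1) := by
  have h := (mem_box.1 (mem_blockCyl_bs.1 x.2)) (idx x.1)
  unfold K; rw [Int.toNat_of_nonneg (by omega)]

/-- `K ≥ 1` on the small cylinder. [folklore] -/
theorem one_le_K (hx : bs x.1 ∈ box 2 ℓ) : 1 ≤ K x := by
  have h := (mem_box.1 hx) (idx x.1)
  have e := K_eq x
  omega

/-- `K ≤ 2ℓ + 2`. [folklore] -/
theorem K_le : K x ≤ 2 * ℓ + 2 := by
  have h := (mem_box.1 (mem_blockCyl_bs.1 x.2)) (idx x.1)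
  have e := K_eq x
  omega

/-- The top of the column of `x`: `p = x s^K`. [folklore] -/
def pt : ↥wreathZ := x.1 * sW ^ K x

/-- Coordinates of the top: own block sum `ℓ + 1`, the other unchanged; same tree part. [folklore] -/
theorem bs_pt : bs (pt x) = bs x.1 + Pi.single (idx x.1) ((ℓ : ℤ) + 1 - bs x.1 (idx x.1)) ∧ idx (pt x) = idx x.1 ∧
    (((pt x : ↥wreathZ)) : LampGroup ℤ).right = ((x.1 : LampGroup ℤ)).right := by
  refine ⟨?_, (bs_mul_sW_pow x.1 (K x)).2, right_mul_sW_pow x.1 (K x)⟩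
  rw [pt, (bs_mul_sW_pow x.1 (K x)).1, K_eq]

/-- The own block sum of the top is `ℓ + 1`. [folklore] -/
theorem bs_pt_idx : bs (pt x) (idx x.1) = ℓ + 1 := by
  rw [(bs_pt x).1, Pi.add_apply, Pi.single_eq_same]; ring

/-- The other block sum of the top is that of `x`. [folklore] -/
theorem bs_pt_ne {j : Fin 2} (hj : j ≠ idx x.1) : bs (pt x) j = bs x.1 j := by
  rw [(bs_pt x).1, Pi.add_apply, Pi.single_eq_of_ne hj, add_zero]

/-- The top lies outside the small cylinder. [folklore] -/
theorem bs_pt_not_mem : bs (pt x) ∉ box 2 ℓ := fun h => by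
  have := (mem_box.1 h) (idx x.1); rw [bs_pt_idx] at this; omega

/-- The column of `x` stays in the big cylinder. [folklore] -/
theorem colA_mem : ∀ z ∈ (powWalk stdGens cay_adj_sW x.1 (K x)).support, z ∈ blockCyl (box 2 (ℓ + 1)) :=
  line_mem x.2 (by have := K_eq x; omega)

/-- The top as a vertex of the big cylinder graph. [folklore] -/
abbrev pV : ↥(blockCyl (box 2 (ℓ + 1))) := ⟨pt x, colA_mem x _ (Walk.end_mem_support _)⟩

/-- **The column of `x`**: `x, x s, …, x s^K = p`, as a walk of the big cylinder graph. [folklore] -/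
def colA : (cylH (ℓ + 1)).Walk x (pV x) := (powWalk stdGens cay_adj_sW x.1 (K x)).induce (blockCyl (box 2 (ℓ + 1))) (colA_mem x)

/-- Vertices of `colA` are `x sⁱ`, `i ≤ K`. [folklore] -/
theorem mem_colA {z : ↥(blockCyl (box 2 (ℓ + 1)))} (hz : z ∈ (colA x).support) : ∃ i, i ≤ K x ∧ z.1 = x.1 * sW ^ i :=
  (mem_support_powWalk _).1 ((mem_support_induce_iff _ (colA_mem x) z).1 hz)

/-- `colA` is a path of length `K`. [folklore] -/
theorem colA_isPath : (colA x).IsPath ∧ (colA x).length = K x :=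
  ⟨(isPath_induce_iff _ _).2 (isPath_powWalk _ sW_pow_injective _ _), (length_induce _ (colA_mem x)).trans (length_powWalk _ _ _)⟩

/-- A vertex `x sⁱ` of the column with own block sum `ℓ + 1` is the top. [folklore] -/
theorem eq_K_of_bs {i : ℕ} (hi : bs (x.1 * sW ^ i) (idx x.1) = ℓ + 1) : i = K x := by
  rw [(bs_mul_sW_pow x.1 i).1, Pi.add_apply, Pi.single_eq_same] at hi
  have e := K_eq x; omega

end Kit

end Grigorchuk

end Summit.CriticalPhenomena.PercolationContinuityZ3.Theorems.Transplant

end
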